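import Summits.HubbardSuperconductivity.HubbardSuperconductivity.Theorems.WidthHaldaneKineticFloor

/-!
# The transverse kinetic floor on the square tori: the kinetic floor at the swapped labelling

Crux `WidthHaldaneBridge` (stmt-HubbardSuperconductivity-16311), line `Sketch` = card
`twist-transfer-floors`, registered stub `stub_transverseFloor`: at `M = L` the hypothesis
`UniformThermo` quantifies over EVERY labelling `e : Λ ≃ ℤ/L × ℤ/L`, in particular over the swapped
labelling `swap ∘ e`; the pure tube Hamiltonian does not see the swap (`tubeH0 L L Λ (swap ∘ e) U =
tubeH0 L L Λ e U`: the nearest-neighbour relation is symmetric in the two directions), while the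
"longitudinal" bonds of `swap ∘ e` are the TRANSVERSE bonds of `e`. Hence the kinetic floor
(`Theorems/WidthHaldaneKineticFloor.lean`) runs through both cycles of the square torus:

  `d₀·L² ≤ Σ_{a,b,σ} Re⟨ψ, (c†_{(a,b)σ} c_{(a,b-1)σ} + c†_{(a,b-1)σ} c_{(a,b)σ}) ψ⟩`

for every normalised `(N_{L,L}(δ), S^z = 0)` ground state of every admissible square torus. PROVED here
(no definition, no named fact):

* `tubeH0_swap` — `tubeH0 L L Λ (e.trans (Equiv.prodComm _ _)) U = tubeH0 L L Λ e U`;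
* `transverseFloor_of_kineticFloor` — the displayed floor from the kinetic floor at the swapped labelling;
* `stub_transverseFloor` — the registered closed form (an implication from the kinetic-floor statement).

References: A. Paramekanti, N. Trivedi, M. Randeria, PRB 57 (1998) 11639, §IV (two-dimensional
resistor network); D. J. Scalapino, S. R. White, S. C. Zhang, PRB 47 (1993) 7995.
-/

noncomputable section

namespace Summit.HubbardSuperconductivity.HubbardSuperconductivity.Theorems.WidthHaldane

set_option linter.dupNamespace false -- summit = problem name (single-conjunct summit), D-0017

open scoped BigOperators Classical Matrix ComplexConjugate
open Matrix Literature.MathematicalPhysics.QuantumLattice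

section Swap

variable (L : ℕ) [NeZero L] (Λ : Type) [LinearOrder Λ] [Fintype Λ] (e : Λ ≃ ZMod L × ZMod L)

omit [NeZero L] [LinearOrder Λ] [Fintype Λ] in
/-- The nearest-neighbour graph of the square torus does not see the swap of the two coordinates.
[folklore] -/
theorem tubeGraph_swap : tubeGraph (e.trans (Equiv.prodComm (ZMod L) (ZMod L))) = tubeGraph e := by
  ext x y
  simp only [SimpleGraph.fromRel_adj, tubeGraph, Equiv.trans_apply, Equiv.prodComm_apply, Prod.swap,
    Equiv.symm_trans_apply, Equiv.prodComm_symm, ne_eq]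
  tauto

omit [NeZero L] in
/-- **The pure Hubbard Hamiltonian of the square torus does not see the swap of the labelling**:
`tubeH0 L L Λ (swap ∘ e) U = tubeH0 L L Λ e U`. [folklore] -/
theorem tubeH0_swap (U : ℝ) : tubeH0 L L Λ (e.trans (Equiv.prodComm (ZMod L) (ZMod L))) U = tubeH0 L L Λ e U := by
  rw [tubeH0_eq, tubeH0_eq]
  have h := tubeGraph_swap L Λ e
  congr 1

/-- **Transverse kinetic floor from the longitudinal one at the swapped labelling.** If at the
labelling `swap ∘ e` of the square torus every normalised sector ground state of `tubeH0` has
longitudinal kinetic energy `≥ d₀·L·L`, then at the labelling `e` every normalised sector ground state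
has TRANSVERSE kinetic energy `≥ d₀·L·L`. [folklore] -/
theorem transverseFloor_of_kineticFloor (U : ℝ) (N : ℕ) (d₀ : ℝ)
    (hKF : ∀ ψ : Fock (Orb Λ), star ψ ⬝ᵥ ψ = 1 →
      IsGroundStateInSector (tubeH0 L L Λ (e.trans (Equiv.prodComm (ZMod L) (ZMod L))) U) N 0 ψ →
        d₀ * (L : ℝ) * (L : ℝ) ≤ ∑ a : ZMod L, ∑ b : ZMod L, ∑ σ : Fin 2,
          (expect (creation (orb ((e.trans (Equiv.prodComm (ZMod L) (ZMod L))).symm (a, b)) σ) *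
              annihilation (orb ((e.trans (Equiv.prodComm (ZMod L) (ZMod L))).symm (a - 1, b)) σ) +
            creation (orb ((e.trans (Equiv.prodComm (ZMod L) (ZMod L))).symm (a - 1, b)) σ) *
              annihilation (orb ((e.trans (Equiv.prodComm (ZMod L) (ZMod L))).symm (a, b)) σ)) ψ).re)
    {ψ : Fock (Orb Λ)} (h1 : star ψ ⬝ᵥ ψ = 1) (hgs : IsGroundStateInSector (tubeH0 L L Λ e U) N 0 ψ) :
    d₀ * (L : ℝ) * (L : ℝ) ≤ ∑ a : ZMod L, ∑ b : ZMod L, ∑ σ : Fin 2,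
      (expect (creation (orb (e.symm (a, b)) σ) * annihilation (orb (e.symm (a, b - 1)) σ) +
        creation (orb (e.symm (a, b - 1)) σ) * annihilation (orb (e.symm (a, b)) σ)) ψ).re := by
  rw [← tubeH0_swap L Λ e U] at hgs
  have h := hKF ψ h1 hgs
  have hsymm : ∀ p q : ZMod L, (e.trans (Equiv.prodComm (ZMod L) (ZMod L))).symm (p, q) = e.symm (q, p) :=
    fun p q => rfl
  simp only [hsymm] at h
  rw [Finset.sum_comm] at h
  exact h

end Swap

/-- **`stub_transverseFloor`** (registered stub of crux stmt-HubbardSuperconductivity-16311, line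
`Sketch` / card `twist-transfer-floors`): the width-uniform kinetic floor, applied at the swapped
labelling of the square torus (`M = L`, where `UniformThermo` quantifies over both labellings), is a
floor on the TRANSVERSE kinetic energy of every normalised sector ground state — the two-dimensional
resistor network of Paramekanti–Trivedi–Randeria. [cite: ParamekantiTrivediRanderia1998, §IV] -/
theorem stub_transverseFloor : (∀ (U δ d₀ k₀ : ℝ) (M₁ L₀ : ℕ), 0 < d₀ → UniformThermo U δ d₀ k₀ M₁ L₀ → ∀ (L M : ℕ) [NeZero L] [NeZero M], Even L → Even M → M₁ ≤ M → M ≤ L → L₀ ≤ L → 3 ≤ L → ∀ (Λ : Type) [LinearOrder Λ] [Fintype Λ] (e : Λ ≃ ZMod L × ZMod M) (ψ : Fock (Orb Λ)), star ψ ⬝ᵥ ψ = 1 → IsGroundStateInSector (tubeH0 L M Λ e U) (tubeFilling L M δ) 0 ψ → d₀ * (L : ℝ) * (M : ℝ) ≤ ∑ a : ZMod L, ∑ b : ZMod M, ∑ σ : Fin 2, (expect (creation (orb (e.symm (a, b)) σ) * annihilation (orb (e.symm (a - 1, b)) σ) + creation (orb (e.symm (a - 1, b)) σ) * annihilation (orb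 (e.symm (a, b)) σ)) ψ).re) → ∀ (U δ d₀ k₀ : ℝ) (M₁ L₀ : ℕ), 0 < d₀ → UniformThermo U δ d₀ k₀ M₁ L₀ → ∀ (L : ℕ) [NeZero L], Even L → M₁ ≤ L → L₀ ≤ L → 3 ≤ L → ∀ (Λ : Type) [LinearOrder Λ] [Fintype Λ] (e : Λ ≃ ZMod L × ZMod L) (ψ : Fock (Orb Λ)), star ψ ⬝ᵥ ψ = 1 → IsGroundStateInSector (tubeH0 L L Λ e U) (tubeFilling L L δ) 0 ψ → d₀ * (L : ℝ) * (L : ℝ) ≤ ∑ a : ZMod L, ∑ b : ZMod L, ∑ σ : Fin 2, (expect (creation (orb (e.symm (a, b)) σ) * annihilation (orb (e.symm (a, b - 1)) σ) + creation (orb (e.symm (a, b - 1)) σ) * annihilation (orb (e.symm (a, b)) σ)) ψ).re := by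
  intro hKF U δ d₀ k₀ M₁ L₀ hd₀ hUT L _ hLe hM₁ hL₀ hL Λ _ _ e ψ h1 hgs
  exact transverseFloor_of_kineticFloor L Λ e U (tubeFilling L L δ) d₀
    (fun φ hφ hgsφ => hKF U δ d₀ k₀ M₁ L₀ hd₀ hUT L L hLe hLe hM₁ le_rfl hL₀ hL Λ
      (e.trans (Equiv.prodComm (ZMod L) (ZMod L))) φ hφ hgsφ) h1 hgs

end Summit.HubbardSuperconductivity.HubbardSuperconductivity.Theorems.WidthHaldane

end
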